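import Literature.NumberTheory.Sieve.Maynard2016NuProd
import HarnessLib

/-!
# Maynard (2016), Lemma 7: the `q`-dependence of `𝔖_{m,q}⁻¹` — displays (6.24)–(6.25), repaired

Trunk: AntSieve / parity (Maynard 2016 large-gaps ladder; named fact
`Literature.NumberTheory.Sieve.Maynard2016.Lemma7Tuple`).

J. Maynard, *Large gaps between primes*, Ann. of Math. 183 (2016) = arXiv:1408.5110, §6, proof of
Lemma 7, displays (6.24)–(6.25): after Lemma 6 the normaliser `α_{m,q}` is `𝔖_{m,q}⁻¹` times a
`q`-free quantity, and the proof needs a lower bound for `𝔖_{m,q}⁻¹` whose `q`-dependence is a sum of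
indicator functions of congruence conditions on `q` ("Expanding out this product then gives …
`Σ_{a_{i,j} ∣ m q(h_i − h_j) − 1} (−2k)^{ω([a])}/[a]`", (6.25)).

In the normalisation of this tree (`𝔖_{m,q} = (classCount/P_w)·singSmall·singLarge`,
`Maynard2016Lemma6Split.singSeriesMQ_eq_classCount_mul`) only `singLarge` depends on `q`, and
`Maynard2016NuProd.exists_prod_mid_eq_singLarge_mul` gives
`∏_{w<p≤y}(1 + ν_p/p) = singLarge · R`, `|R − 1| ≤ e^{24k²/(w+1)} − 1`, with `ν_p = k` for `p ∣ m` and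
`ν_p = #M_p(q)` (`M_p(q) = couplingSet k x m q p = {(i,j) : p ∣ m q(h_j − h_i) − 1}`) otherwise.  This
file records the resulting FACTORISATION and a FIRST-ORDER lower bound replacing (6.25):

* `prod_mid_eq_mPart_mul_vPart` : `∏_{w<p≤y}(1 + ν_p/p) = Π_m · V_q⁻¹…` — precisely
  `= mPart k ε x m * vPart k ε x m q` with `mPart = ∏_{p ∣ m}(1 + k/p)` (independent of `q`) and
  `vPart = ∏_{p ∤ m}(1 + #M_p(q)/p)`;
* `exists_inv_singLarge_eq` : `singLarge⁻¹ = R/(mPart · vPart)` with the bound on `R`;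
* `one_sub_sum_le_inv_prod_one_add` : `1 − Σ u_p ≤ (∏(1 + u_p))⁻¹` for `u_p ≥ 0`, whence
  `one_sub_sum_le_inv_vPart` : `vPart⁻¹ ≥ 1 − Σ_{w<p≤y, p∤m} #M_p(q)/p`;
* `sum_card_couplingSet_div_eq` : `Σ_p #M_p(q)/p = Σ_{(i,j)} Σ_{p : p ∣ m q(h_j − h_i) − 1} 1/p` — each
  inner condition is ONE congruence on `q` modulo `p`, the form in which the `q`-sum of Lemma 7 can
  absorb it (Maynard: "for any `p ∣ a_{i,j}` we have `K_p ≪_k p⁻¹`", p. 12).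

Remark (why not (6.24)–(6.25) verbatim).  The `m`-part `mPart` must be kept: for `p ∣ m`, `w < p ≤ y`
one has `ω_{m,q}(p) = k`, and `∏_{p∣m, p>w}(1 + k/p)⁻¹` is not `1 + o(1)` uniformly in the admissible
`m`; it cancels only at the end of the proof against the same primes in `𝔖^{(2)}` and in `#𝓡_m`
(Lemma 3).  And the expansion of `∏_{p ∣ N_q}(1 − 2k/p)` over tuples `(a_{i,j})` is not an identity (a
prime may divide several of the linear forms); the union bound behind `one_sub_sum_le_inv_vPart` +
`sum_card_couplingSet_div_eq` is the rigorous first-order substitute, and it loses only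
`O_k(Σ_{p>w} p⁻²) = o_k(1)` once each congruence-restricted `q`-sum is `≪_k p⁻¹` times the full one.

## References

* J. Maynard, *Large gaps between primes*, Ann. of Math. (2) 183 (2016), 915–933; arXiv:1408.5110,
  §6, proof of Lemma 7, displays (6.24)–(6.25). [Maynard2016LargeGaps]
-/

noncomputable section

open Finset Real
open scoped BigOperators

namespace Literature.NumberTheory.Sieve

namespace Maynard2016

open LcmEuler

/-! ### The two parts of `∏_{w<p≤y}(1 + ν_p/p)` -/

/-- `Π_m = ∏_{w < p ≤ y, p ∣ m} (1 + k/p)` — the `q`-independent part. [cite: Maynard2016LargeGaps, Lemma 7 (proof, display (6.24))] -/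
def mPart (k : ℕ) (ε : ℝ) (x m : ℕ) : ℝ :=
  ∏ p ∈ (midPrimes ε x).filter (fun p => p ∣ m), (1 + (k : ℝ) / p)

/-- `V_q = ∏_{w < p ≤ y, p ∤ m} (1 + #M_p(q)/p)` — the `q`-dependent part. [cite: Maynard2016LargeGaps, Lemma 7 (proof, display (6.24))] -/
def vPart (k : ℕ) (ε : ℝ) (x m q : ℕ) : ℝ :=
  ∏ p ∈ (midPrimes ε x).filter (fun p => ¬ p ∣ m), (1 + ((couplingSet k x m q p).card : ℝ) / p)

/-- `Π_m > 0`. [cite: Maynard2016LargeGaps, Lemma 7 (proof, display (6.24))] -/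
theorem mPart_pos (k : ℕ) (ε : ℝ) (x m : ℕ) : 0 < mPart k ε x m :=
  Finset.prod_pos fun p _ => by positivity

/-- `1 ≤ Π_m`. [cite: Maynard2016LargeGaps, Lemma 7 (proof, display (6.24))] -/
theorem one_le_mPart (k : ℕ) (ε : ℝ) (x m : ℕ) : 1 ≤ mPart k ε x m := by
  unfold mPart
  calc (1 : ℝ) = ∏ p ∈ (midPrimes ε x).filter (fun p => p ∣ m), (1 : ℝ) := by simp
    _ ≤ _ := Finset.prod_le_prod (fun _ _ => zero_le_one) fun p _ => by
        have : (0 : ℝ) ≤ (k : ℝ) / p := by positivity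
        linarith

/-- `V_q > 0`. [cite: Maynard2016LargeGaps, Lemma 7 (proof, display (6.24))] -/
theorem vPart_pos (k : ℕ) (ε : ℝ) (x m q : ℕ) : 0 < vPart k ε x m q :=
  Finset.prod_pos fun p _ => by positivity

/-- `1 ≤ V_q`. [cite: Maynard2016LargeGaps, Lemma 7 (proof, display (6.24))] -/
theorem one_le_vPart (k : ℕ) (ε : ℝ) (x m q : ℕ) : 1 ≤ vPart k ε x m q := by
  unfold vPart
  calc (1 : ℝ) = ∏ p ∈ (midPrimes ε x).filter (fun p => ¬ p ∣ m), (1 : ℝ) := by simp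
    _ ≤ _ := Finset.prod_le_prod (fun _ _ => zero_le_one) fun p _ => by
        have : (0 : ℝ) ≤ ((couplingSet k x m q p).card : ℝ) / p := by positivity
        linarith

/-- **`∏_{w<p≤y}(1 + ν_p/p) = Π_m · V_q`** (`ν_p = k` if `p ∣ m`, `#M_p(q)` otherwise).
[cite: Maynard2016LargeGaps, Lemma 7 (proof, display (6.24))] -/
theorem prod_mid_eq_mPart_mul_vPart (k : ℕ) (ε : ℝ) (x m q : ℕ) :
    ∏ p ∈ midPrimes ε x, (1 + (coupledNu m (couplingSet k x m q) p : ℝ) / p) =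
      mPart k ε x m * vPart k ε x m q := by
  rw [mPart, vPart, ← Finset.prod_filter_mul_prod_filter_not (midPrimes ε x) (fun p => p ∣ m)]
  congr 1
  · refine Finset.prod_congr rfl fun p hp => ?_
    have hpm : p ∣ m := (Finset.mem_filter.1 hp).2
    unfold coupledNu
    rw [if_pos hpm, Fintype.card_fin]
  · refine Finset.prod_congr rfl fun p hp => ?_
    have hpm : ¬ p ∣ m := (Finset.mem_filter.1 hp).2
    unfold coupledNu
    rw [if_neg hpm]

/-- **Factorisation of `singLarge⁻¹`:** for `4k ≤ w + 1`, `q` with no prime factor in `(w, y]` and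
the `h_j − h_i` (`i ≠ j`) free of primes in `(w, y]`,
`singLarge⁻¹ = R/(Π_m · V_q)` with `|R − 1| ≤ e^{24k²/(w+1)} − 1`. [cite: Maynard2016LargeGaps, Lemma 7 (proof, display (6.24))] -/
theorem exists_inv_singLarge_eq {k x m q : ℕ} {ε : ℝ} (hk : 4 * k ≤ ⌊wFun x⌋₊ + 1)
    (hk' : 2 * k ≤ ⌊wFun x⌋₊) (hpq : ∀ p ∈ midPrimes ε x, ¬ p ∣ q)
    (hdist : ∀ p ∈ midPrimes ε x, ∀ i j : Fin k, i ≠ j →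
      ¬ (p : ℤ) ∣ (hTuple k x j : ℤ) - hTuple k x i) :
    ∃ R : ℝ, |R - 1| ≤ Real.exp (24 * (k : ℝ) ^ 2 / (⌊wFun x⌋₊ + 1)) - 1 ∧
      (singLarge k ε x m q)⁻¹ = R / (mPart k ε x m * vPart k ε x m q) := by
  obtain ⟨R, hR, hRb⟩ := exists_prod_mid_eq_singLarge_mul (m := m) (q := q) (ε := ε) hk hpq hdist
  refine ⟨R, hRb, ?_⟩
  rw [prod_mid_eq_mPart_mul_vPart] at hR
  have hS : 0 < singLarge k ε x m q := singLarge_pos hk' ε m q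
  have hMV : 0 < mPart k ε x m * vPart k ε x m q := mul_pos (mPart_pos k ε x m) (vPart_pos k ε x m q)
  have hR0 : R ≠ 0 := by
    rintro rfl
    rw [mul_zero] at hR
    exact hMV.ne' hR
  rw [hR]
  field_simp

/-! ### The first-order lower bound for `V_q⁻¹` -/

/-- **`1 − Σ u_i ≤ (∏ (1 + u_i))⁻¹` for `u_i ≥ 0`** (`∏(1+u) ≤ e^{Σu}` and `1 − s ≤ e^{−s}`). [folklore] -/
private theorem one_sub_sum_le_inv_prod_one_add {α : Type*} (s : Finset α) {u : α → ℝ}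
    (hu : ∀ i ∈ s, 0 ≤ u i) : 1 - ∑ i ∈ s, u i ≤ (∏ i ∈ s, (1 + u i))⁻¹ := by
  have hprod_pos : 0 < ∏ i ∈ s, (1 + u i) := Finset.prod_pos fun i hi => by linarith [hu i hi]
  have hle : ∏ i ∈ s, (1 + u i) ≤ Real.exp (∑ i ∈ s, u i) := by
    rw [Real.exp_sum]
    exact Finset.prod_le_prod (fun i hi => by linarith [hu i hi]) fun i _ => by
      linarith [Real.add_one_le_exp (u i)]
  calc 1 - ∑ i ∈ s, u i ≤ Real.exp (-(∑ i ∈ s, u i)) := by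
        linarith [Real.add_one_le_exp (-(∑ i ∈ s, u i))]
    _ = (Real.exp (∑ i ∈ s, u i))⁻¹ := Real.exp_neg _
    _ ≤ (∏ i ∈ s, (1 + u i))⁻¹ := inv_anti₀ hprod_pos hle

/-- **`V_q⁻¹ ≥ 1 − Σ_{w<p≤y, p∤m} #M_p(q)/p`** (the first-order substitute for (6.25)).
[cite: Maynard2016LargeGaps, Lemma 7 (proof, display (6.25))] -/
theorem one_sub_sum_le_inv_vPart (k : ℕ) (ε : ℝ) (x m q : ℕ) :
    1 - ∑ p ∈ (midPrimes ε x).filter (fun p => ¬ p ∣ m), ((couplingSet k x m q p).card : ℝ) / p ≤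
      (vPart k ε x m q)⁻¹ :=
  one_sub_sum_le_inv_prod_one_add _ fun p _ => by positivity

/-- `V_q⁻¹ ≤ 1`. [cite: Maynard2016LargeGaps, Lemma 7 (proof, display (6.25))] -/
theorem inv_vPart_le_one (k : ℕ) (ε : ℝ) (x m q : ℕ) : (vPart k ε x m q)⁻¹ ≤ 1 :=
  inv_le_one_of_one_le₀ (one_le_vPart k ε x m q)

/-- **The `q`-dependence is a sum of single congruence conditions on `q`:**
`Σ_{p ∈ S} #M_p(q)/p = Σ_{(i,j)} Σ_{p ∈ S, p ∣ m q(h_j − h_i) − 1} 1/p`. [cite: Maynard2016LargeGaps, Lemma 7 (proof, display (6.25))] -/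
theorem sum_card_couplingSet_div_eq (k x m q : ℕ) (S : Finset ℕ) :
    ∑ p ∈ S, ((couplingSet k x m q p).card : ℝ) / p =
      ∑ ij : Fin k × Fin k, ∑ p ∈ S.filter (fun p : ℕ =>
        ((p : ℕ) : ℤ) ∣ (m : ℤ) * q * ((hTuple k x ij.2 : ℤ) - hTuple k x ij.1) - 1), (1 : ℝ) / p := by
  classical
  have h1 : ∀ p ∈ S, ((couplingSet k x m q p).card : ℝ) / p =
      ∑ ij : Fin k × Fin k, if (p : ℤ) ∣ (m : ℤ) * q * ((hTuple k x ij.2 : ℤ) - hTuple k x ij.1) - 1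
        then (1 : ℝ) / p else 0 := by
    intro p _
    rw [← Finset.sum_filter]
    rw [Finset.sum_const, nsmul_eq_mul, couplingSet]
    ring
  rw [Finset.sum_congr rfl h1, Finset.sum_comm]
  refine Finset.sum_congr rfl fun ij _ => ?_
  rw [Finset.sum_filter]

/-- The diagonal carries no condition: `(i, i) ∉ M_p(q)` for a prime `p` (`p ∤ −1`), so only the
`k(k−1)` off-diagonal pairs contribute. [cite: Maynard2016LargeGaps, Lemma 7 (proof, display (6.25))] -/
theorem not_mem_couplingSet_diag {k x m q p : ℕ} (hp : p.Prime) (i : Fin k) :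
    (i, i) ∉ couplingSet k x m q p := by
  intro h
  have h' := (Finset.mem_filter.1 h).2
  simp only [sub_self, mul_zero, zero_sub] at h'
  have : (p : ℤ) ∣ 1 := (dvd_neg).1 h'
  have hp1 : (p : ℤ).natAbs = 1 := Int.eq_one_of_dvd_one (by positivity) this |> fun h => by
    simpa using congrArg Int.natAbs h
  simp at hp1
  exact hp.one_lt.ne' hp1

/-- `#M_p(q) ≤ k²` (all pairs). [cite: Maynard2016LargeGaps, §6 display (6.13)] -/
theorem card_couplingSet_le (k x m q p : ℕ) : (couplingSet k x m q p).card ≤ k * k := by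
  calc (couplingSet k x m q p).card ≤ (Finset.univ : Finset (Fin k × Fin k)).card :=
        Finset.card_le_univ _
    _ = k * k := by rw [Finset.card_univ, Fintype.card_prod, Fintype.card_fin]

end Maynard2016

end Literature.NumberTheory.Sieve

end
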